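import Summits.QuantumFields.YangMills.Theorems.ConvexGribovBodyNonSimplyConnectedLatticeGapStubGaugeInvariantUniqueness
import Literature.Probability.LatticeModels.GibbsSpecificationDLRProofs
import HarnessLib

/-!
# Weak mixing on cubes for one observable implies exponential clustering in every DLR state
# (stub `stub_infiniteVolumeClustering_of_boxInfluenceDecay` (NU) of crux stmt-QuantumFields-16405,
# route `ConvexGribovBody`, line `Sketch` v8)

For the lattice Yang–Mills specification `γ = ymSpecification ρ β` on `ℤ⁴` (compact metrisable gauge group `G`,
continuous representation `ρ`, any real `β`): if the cube influence of the local observable `A` decays,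
`|γ_{Λ_L}(A | η) − γ_{Λ_L}(A | η')| ≤ C e^{−mL}` for all cubes of links `Λ_L = [−L, L]⁴ × univ` and all exterior data
(rate `m ≥ 0`), then in EVERY DLR state `μ ∈ 𝒢(γ)` the observable `A` decorrelates exponentially, at the same rate,
from the translates `B ∘ θ_x` (`θ_x = configShift x`, `(θ_x U)(y, j) = U(y − x, j)`) of every local observable `B`:
`|μ(A · B∘θ_x) − μ(A) μ(B∘θ_x)| ≤ C' e^{−mn}` whenever `|x_i| ≥ n` for some direction `i`.

Proof (Georgii 2011 §8.2, (8.29)–(8.31), infinite-volume form). Let `R_B` be the sup-norm radius of the support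
of `B`. For `n ≥ R_B + 1` put `L = n − R_B − 1`; the support of `B ∘ θ_x` consists of links `(y − x, j)` with
`|y_i| ≤ R_B`, so `|(y − x)_i| ≥ n − R_B = L + 1` and it misses the cube `Λ_L`. The DLR equation with a far factor
(`integral_mul_eq_integral_boxMean_mul_of_isGibbsMeasure`: `μ(F h) = ∫ γ_Λ(F | η) h(η) dμ(η)` for `h` depending
only on links off `Λ`, from the DLR equation for the observable `F h`, `IsGibbsMeasure.integral_integral_eq`, and
properness of the kernels) and the plain DLR equation `μ(F) = ∫ γ_Λ(F | η) dμ(η)` give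
`μ(A h) − μ(A) μ(h) = ∫ (γ_Λ(A | η) − μ(A)) h(η) dμ(η)` with `|γ_Λ(A | η) − μ(A)| ≤ C e^{−mL}`
(`abs_integral_sub_boxMean_le_of_isGibbsMeasure`), whence the bound `‖B‖_∞ C e^{−mL} = ‖B‖_∞ C e^{m(R_B+1)} e^{−mn}`
(`abs_cov_le_of_boxInfluence_of_isGibbsMeasure`). For `n ≤ R_B` the trivial bound `2 ‖A‖_∞ ‖B‖_∞` suffices.

References: H.-O. Georgii, *Gibbs Measures and Phase Transitions*, 2nd ed. (de Gruyter 2011), §8.2;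
S. Friedli, Y. Velenik, *Statistical Mechanics of Lattice Systems* (CUP 2017), §6.3.1, Exercise 6.6.
-/

set_option autoImplicit false

noncomputable section

open MeasureTheory
open Literature.Probability.LatticeModels hiding configShift configShift_apply
open Literature.MathematicalPhysics.QuantumLattice
open Literature.MathematicalPhysics.QuantumFieldTheory (isSpecification_ymSpecification_of_t2Space)

namespace Summit.QuantumFields.YangMills.Theorems.NonSimplyConnectedLatticeGap

section Helpers

variable {G : Type} [Group G] [TopologicalSpace G] [IsTopologicalGroup G] [CompactSpace G]
  [MeasurableSpace G] [BorelSpace G] [SecondCountableTopology G] [T2Space G]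
  {N : ℕ} (ρ : G →* Matrix (Fin N) (Fin N) ℂ)

/-- **DLR equation with a far factor (infinite volume).** For a DLR state `κ` of `ymSpecification ρ β`, a bounded
measurable observable `F`, a finite link set `Λ` and a bounded measurable cylinder observable `h` whose support
`T` misses `Λ`: `∫ F h dκ = ∫ γ_Λ(F | η) h(η) dκ(η)`. Indeed `∫ F h dκ = ∫ γ_Λ(F h | η) dκ(η)` (DLR equation for
the observable `F h`, `IsGibbsMeasure.integral_integral_eq`), and `γ_Λ(F h | η) = h(η) γ_Λ(F | η)` because
`γ_Λ(· | η)`-a.e. configuration agrees with `η` off `Λ`, hence on `T` (properness, `IsSpecification.proper`)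
(Georgii 2011, Remark 1.20 and (8.30); Friedli–Velenik 2017, Lemma 6.13). -/
theorem integral_mul_eq_integral_boxMean_mul_of_isGibbsMeasure (hρ : Continuous ρ) (β : ℝ)
    {κ : Measure (LGConfig 4 G)} (hκ : IsGibbsMeasure (ymSpecification ρ β) κ) (Λ : Finset (ZdEdge 4))
    {F : LGConfig 4 G → ℝ} (hFm : Measurable F) {C : ℝ} (hC : ∀ U, |F U| ≤ C)
    {h : LGConfig 4 G → ℝ} (hhm : Measurable h) {D : ℝ} (hD : ∀ U, |h U| ≤ D)
    {T : Finset (ZdEdge 4)} (hhT : IsCylinder h T) (hTΛ : Disjoint T Λ) :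
    ∫ U, F U * h U ∂κ = ∫ η, (∫ U, F U ∂(ymSpecification ρ β Λ η)) * h η ∂κ := by
  have hγ := isSpecification_ymSpecification_of_t2Space (d := 4) ρ hρ β
  haveI := hκ.isProbabilityMeasure
  -- properness: the far factor is `γ_Λ(· | η)`-a.s. equal to its value at the exterior datum
  have hprop : ∀ η : LGConfig 4 G, ∫ U, F U * h U ∂(ymSpecification ρ β Λ η) =
      (∫ U, F U ∂(ymSpecification ρ β Λ η)) * h η := by
    intro η
    rw [← integral_mul_const]
    refine integral_congr_ae ?_
    filter_upwards [hγ.proper Λ η] with σ hσ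
    rw [hhT fun e he => hσ e (Finset.disjoint_left.1 hTΛ (Finset.mem_coe.1 he))]
  -- the DLR equation for the integrable observable `F h`
  have hFh : Integrable (fun U => F U * h U) κ :=
    integrable_of_abs_le (hFm.mul hhm) (C := C * D) fun U => by
      rw [abs_mul]
      exact mul_le_mul (hC U) (hD U) (abs_nonneg _) ((abs_nonneg _).trans (hC U))
  rw [← hκ.integral_integral_eq hγ Λ hFh]
  exact integral_congr_ae (ae_of_all _ fun η => hprop η)

/-- **Covariances in a DLR state are controlled by the boundary influence of one kernel** (infinite-volume form
of `FiniteSizeCriterion.abs_latticeConnectedCorr_le_of_influence`; Georgii 2011, §8.2, (8.29)–(8.31)). DLR state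
`κ` of `ymSpecification ρ β`; bounded measurable `F`; bounded measurable cylinder observable `h` (bound `D`) whose
support misses the finite link set `Λ`. If the kernel means `γ_Λ(F | η)` vary by at most `Δ` over all exterior
data, then `|κ(F h) − κ(F) κ(h)| ≤ D Δ`: by the far-factor DLR equation and `κ(F) = ∫ γ_Λ(F | η) dκ(η)` the
covariance is `∫ (γ_Λ(F | η) − κ(F)) h(η) dκ(η)`, and `|γ_Λ(F | η) − κ(F)| ≤ Δ`
(`abs_integral_sub_boxMean_le_of_isGibbsMeasure`). -/
theorem abs_cov_le_of_boxInfluence_of_isGibbsMeasure (hρ : Continuous ρ) (β : ℝ)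
    {κ : Measure (LGConfig 4 G)} (hκ : IsGibbsMeasure (ymSpecification ρ β) κ) (Λ : Finset (ZdEdge 4))
    {F : LGConfig 4 G → ℝ} (hFm : Measurable F) {C : ℝ} (hC : ∀ U, |F U| ≤ C)
    {h : LGConfig 4 G → ℝ} (hhm : Measurable h) {D : ℝ} (hD : ∀ U, |h U| ≤ D)
    {T : Finset (ZdEdge 4)} (hhT : IsCylinder h T) (hTΛ : Disjoint T Λ) {Δ : ℝ}
    (hΔ : ∀ η η' : LGConfig 4 G,
      |(∫ U, F U ∂(ymSpecification ρ β Λ η)) - ∫ U, F U ∂(ymSpecification ρ β Λ η')| ≤ Δ) :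
    |(∫ U, F U * h U ∂κ) - (∫ U, F U ∂κ) * ∫ U, h U ∂κ| ≤ D * Δ := by
  have hγ := isSpecification_ymSpecification_of_t2Space (d := 4) ρ hρ β
  haveI := hκ.isProbabilityMeasure
  -- the kernel mean of `F`: measurable, bounded, and within `Δ` of `κ(F)`
  have hgm : Measurable fun η : LGConfig 4 G => ∫ U, F U ∂(ymSpecification ρ β Λ η) := by
    -- adapted from `Literature.Probability.LatticeModels.DobrushinShlosman.measurable_windowAvg'`
    let k : ProbabilityTheory.Kernel (LGConfig 4 G) (LGConfig 4 G) :=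
      ⟨ymSpecification ρ β Λ, hγ.measurable_fun Λ⟩
    exact (hFm.stronglyMeasurable.integral_kernel (κ := k)).measurable
  have hgb : ∀ η : LGConfig 4 G, |∫ U, F U ∂(ymSpecification ρ β Λ η)| ≤ C := fun η =>
    abs_integral_ymSpecification_le ρ hρ β Λ hC η
  have hosc : ∀ η : LGConfig 4 G, |(∫ U, F U ∂(ymSpecification ρ β Λ η)) - ∫ U, F U ∂κ| ≤ Δ := by
    intro η
    rw [abs_sub_comm]
    exact abs_integral_sub_boxMean_le_of_isGibbsMeasure ρ hρ β hκ Λ hFm hC η fun η' => hΔ η' η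
  -- the far-factor DLR equation and the covariance through the kernel mean
  have h1 := integral_mul_eq_integral_boxMean_mul_of_isGibbsMeasure ρ hρ β hκ Λ hFm hC hhm hD hhT hTΛ
  have hgHi : Integrable (fun η => (∫ U, F U ∂(ymSpecification ρ β Λ η)) * h η) κ :=
    integrable_of_abs_le (hgm.mul hhm) (C := C * D) fun η => by
      rw [abs_mul]
      exact mul_le_mul (hgb η) (hD η) (abs_nonneg _) ((abs_nonneg _).trans (hgb η))
  have hHi : Integrable h κ := integrable_of_abs_le hhm hD
  have hcov : (∫ U, F U * h U ∂κ) - (∫ U, F U ∂κ) * ∫ U, h U ∂κ =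
      ∫ η, ((∫ U, F U ∂(ymSpecification ρ β Λ η)) - ∫ U, F U ∂κ) * h η ∂κ := by
    rw [h1]
    simp_rw [sub_mul]
    rw [integral_sub hgHi (hHi.const_mul _), integral_const_mul]
  rw [hcov]
  calc |∫ η, ((∫ U, F U ∂(ymSpecification ρ β Λ η)) - ∫ U, F U ∂κ) * h η ∂κ|
      ≤ Δ * D := abs_integral_le_of_abs_le fun η => by
        rw [abs_mul]
        exact mul_le_mul (hosc η) (hD η) (abs_nonneg _) ((abs_nonneg _).trans (hosc η))
    _ = D * Δ := mul_comm _ _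

end Helpers

/-- **Weak mixing on cubes for `A` ⇒ exponential clustering of `A` with all translates of local observables, in
every DLR state** (registered stub `stub_infiniteVolumeClustering_of_boxInfluenceDecay` (NU) of the skeleton
`Cruxes/NonSimplyConnectedLatticeGap/Lines/Sketch.lean` v8 of item stmt-QuantumFields-16405): if
`|γ_{Λ_L}(A | η) − γ_{Λ_L}(A | η')| ≤ C e^{−mL}` for all cubes `Λ_L` and all exterior data (`m ≥ 0`), then for
every DLR state `μ` of `ymSpecification ρ β` and every local observable `B` there is `C'` with
`|μ(A · B∘θ_x) − μ(A) μ(B∘θ_x)| ≤ C' e^{−mn}` whenever `|x_i| ≥ n` for some `i`. With `R_B` the radius of the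
support of `B` and `C' = (2‖A‖_∞‖B‖_∞ + ‖B‖_∞ C) e^{m(R_B+1)}`: for `n ≥ R_B + 1` the support of `B ∘ θ_x` misses
the cube of radius `L = n − R_B − 1` and `abs_cov_le_of_boxInfluence_of_isGibbsMeasure` gives
`‖B‖_∞ C e^{−mL} = ‖B‖_∞ C e^{m(R_B+1)} e^{−mn}`; for `n ≤ R_B` the trivial bound `2‖A‖_∞‖B‖_∞` suffices
(Georgii 2011, §8.2). -/
theorem stub_infiniteVolumeClustering_of_boxInfluenceDecay : ∀ (G : Type) [Group G] [TopologicalSpace G] [IsTopologicalGroup G] [CompactSpace G] [MeasurableSpace G] [BorelSpace G] [SecondCountableTopology G] [T2Space G] (N : ℕ) (ρ : G →* Matrix (Fin N) (Fin N) ℂ), Continuous ρ → ∀ (β m : ℝ), 0 ≤ m → ∀ (A B : Literature.MathematicalPhysics.QuantumLattice.LocalGaugeObservable 4 G) (C : ℝ), (∀ (L : ℕ) (η η' : Literature.MathematicalPhysics.QuantumLattice.LGConfig 4 G), |(∫ U, A.F U ∂(Literature.MathematicalPhysics.QuantumLattice.ymSpecification ρ β ((Fintype.piFinset fun _ : Fin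 4 => Finset.Icc (-((L : ℕ) : ℤ)) ((L : ℕ) : ℤ)) ×ˢ (Finset.univ : Finset (Fin 4))) η)) - ∫ U, A.F U ∂(Literature.MathematicalPhysics.QuantumLattice.ymSpecification ρ β ((Fintype.piFinset fun _ : Fin 4 => Finset.Icc (-((L : ℕ) : ℤ)) ((L : ℕ) : ℤ)) ×ˢ (Finset.univ : Finset (Fin 4))) η')| ≤ C * Real.exp (-(m * L))) → ∀ μ : MeasureTheory.Measure (Literature.MathematicalPhysics.QuantumLattice.LGConfig 4 G), μ ∈ Literature.MathematicalPhysics.QuantumLattice.ymGibbsMeasures ρ β → ∃ C' : ℝ, ∀ (n : ℕ) (x : Literature.Probability.LatticeModels.Site 4), (∃ i : Fin 4, (n : ℤ) ≤ |x i|) → |(∫ U, A.F U * B.F (Literature.MathematicalPhysics.QuantumLattice.configShift x U) ∂μ) - (∫ U, A.F U ∂μ) * ∫ U, B.F (Literature.MathematicalPhysics.QuantumLattice.configShift x U) ∂μ| ≤ C' * Real.exp (-(m * n)) := by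
  intro G _ _ _ _ _ _ _ _ N ρ hρ β m hm A B C hC μ hμ
  have hμ' : IsGibbsMeasure (ymSpecification ρ β) μ :=
    (Literature.MathematicalPhysics.QuantumLattice.mem_ymGibbsMeasures_iff ρ β μ).1 hμ
  haveI := hμ'.isProbabilityMeasure
  obtain ⟨CA, hCA⟩ := A.bounded
  obtain ⟨CB, hCB⟩ := B.bounded
  have hCA0 : 0 ≤ CA := (abs_nonneg _).trans (hCA fun _ => 1)
  have hCB0 : 0 ≤ CB := (abs_nonneg _).trans (hCB fun _ => 1)
  have hC0 : 0 ≤ C := by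
    have h1 : (0 : ℝ) ≤ C * Real.exp (-(m * ((0 : ℕ) : ℝ))) := (abs_nonneg _).trans (hC 0 1 1)
    simpa using h1
  -- the radius of the support of `B`
  set RB : ℕ := B.supp.sup fun e => Finset.univ.sup fun i => (e.1 i).natAbs
  have hRB : ∀ e ∈ B.supp, ∀ i, |e.1 i| ≤ RB := fun e he i => by
    -- adapted from `clustering_of_boxInfluenceDecay_at`
    rw [Int.abs_eq_natAbs, Int.ofNat_le]
    exact (Finset.le_sup (f := fun i => (e.1 i).natAbs) (Finset.mem_univ i)).trans
      (Finset.le_sup (f := fun e : ZdEdge 4 => Finset.univ.sup fun i => (e.1 i).natAbs) he)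
  clear_value RB
  -- the constant
  refine ⟨(2 * CA * CB + CB * C) * Real.exp (m * (RB + 1)), ?_⟩
  rintro n x ⟨i, hi⟩
  have hK0 : 0 ≤ 2 * CA * CB + CB * C := by positivity
  -- the trivial bound
  have htriv : |(∫ U, A.F U * B.F (configShift x U) ∂μ) -
      (∫ U, A.F U ∂μ) * ∫ U, B.F (configShift x U) ∂μ| ≤ 2 * CA * CB := by
    have h1 : |∫ U, A.F U * B.F (configShift x U) ∂μ| ≤ CA * CB :=
      abs_integral_le_of_abs_le fun U => by
        rw [abs_mul]
        exact mul_le_mul (hCA _) (hCB _) (abs_nonneg _) hCA0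
    have h2 : |∫ U, A.F U ∂μ| ≤ CA := abs_integral_le_of_abs_le fun U => hCA _
    have h3 : |∫ U, B.F (configShift x U) ∂μ| ≤ CB := abs_integral_le_of_abs_le fun U => hCB _
    calc _ ≤ |∫ U, A.F U * B.F (configShift x U) ∂μ| +
          |(∫ U, A.F U ∂μ) * ∫ U, B.F (configShift x U) ∂μ| := abs_sub _ _
      _ ≤ CA * CB + CA * CB := by
          rw [abs_mul]
          exact add_le_add h1 (mul_le_mul h2 h3 (abs_nonneg _) hCA0)
      _ = 2 * CA * CB := by ring
  by_cases hcase : RB + 1 ≤ n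
  swap
  · -- `n ≤ R_B`: the trivial bound suffices
    have hnle : (n : ℝ) ≤ RB + 1 := by exact_mod_cast (not_le.1 hcase).le
    have hexp : 1 ≤ Real.exp (m * (RB + 1)) * Real.exp (-(m * n)) := by
      rw [← Real.exp_add]
      refine Real.one_le_exp ?_
      have h := mul_le_mul_of_nonneg_left hnle hm
      linarith only [h]
    calc |(∫ U, A.F U * B.F (configShift x U) ∂μ) -
          (∫ U, A.F U ∂μ) * ∫ U, B.F (configShift x U) ∂μ| ≤ 2 * CA * CB := htriv
      _ ≤ (2 * CA * CB + CB * C) * 1 := by linarith only [mul_nonneg hCB0 hC0]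
      _ ≤ (2 * CA * CB + CB * C) * (Real.exp (m * (RB + 1)) * Real.exp (-(m * n))) :=
          mul_le_mul_of_nonneg_left hexp hK0
      _ = (2 * CA * CB + CB * C) * Real.exp (m * (RB + 1)) * Real.exp (-(m * n)) := by ring
  · -- the main case: the cube of radius `L = n - R_B - 1` misses the support of `B ∘ θ_x`
    obtain ⟨L, hL⟩ : ∃ L : ℕ, L = n - RB - 1 := ⟨_, rfl⟩
    have hLn : L + RB + 1 = n := by omega
    have hLnZ : (L : ℤ) + RB + 1 = n := by exact_mod_cast hLn
    -- the cube `Λ` of radius `L`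
    obtain ⟨Λ, hΛ⟩ : ∃ Λ : Finset (ZdEdge 4), Λ = (Fintype.piFinset fun _ : Fin 4 =>
      Finset.Icc (-((L : ℕ) : ℤ)) ((L : ℕ) : ℤ)) ×ˢ (Finset.univ : Finset (Fin 4)) := ⟨_, rfl⟩
    -- the support of the translate of `B` and its disjointness from `Λ`
    have hhT : IsCylinder (fun U : LGConfig 4 G => B.F (configShift x U))
        (B.supp.image fun e : ZdEdge 4 => (e.1 - x, e.2)) :=
      Literature.MathematicalPhysics.QuantumFieldTheory.IsCylinder.comp_configShift B.isCylinder x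
    have hdisj : Disjoint (B.supp.image fun e : ZdEdge 4 => (e.1 - x, e.2)) Λ := by
      rw [Finset.disjoint_left]
      intro e he heΛ
      obtain ⟨e₀, he₀, rfl⟩ := Finset.mem_image.1 he
      have h0 := abs_le.1 (hRB e₀ he₀ i)
      rw [hΛ, Finset.mem_product, Fintype.mem_piFinset] at heΛ
      have h1 : -(L : ℤ) ≤ e₀.1 i - x i ∧ e₀.1 i - x i ≤ L := by
        simpa only [Pi.sub_apply, Finset.mem_Icc] using heΛ.1 i
      rcases le_abs.1 hi with h | h
      · linarith only [h0.2, h1.1, h, hLnZ]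
      · linarith only [h0.1, h1.2, h, hLnZ]
    -- the covariance bound from the cube influence on `Λ`
    have hinfl := hC L
    rw [← hΛ] at hinfl
    have hcov : |(∫ U, A.F U * B.F (configShift x U) ∂μ) -
        (∫ U, A.F U ∂μ) * ∫ U, B.F (configShift x U) ∂μ| ≤ CB * (C * Real.exp (-(m * L))) :=
      abs_cov_le_of_boxInfluence_of_isGibbsMeasure ρ hρ β hμ' Λ A.measurable hCA
        (h := fun U : LGConfig 4 G => B.F (configShift x U))
        (B.measurable.comp (configShift x).measurable) (fun U => hCB _) hhT hdisj
        fun η η' => hinfl η η'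
    -- compare with `C' e^{−m n}` using `L = n − R_B − 1`
    have hLr : (L : ℝ) + RB + 1 = n := by exact_mod_cast hLn
    have hexp : Real.exp (-(m * L)) = Real.exp (m * (RB + 1)) * Real.exp (-(m * n)) := by
      rw [← Real.exp_add, ← hLr]
      ring_nf
    calc |(∫ U, A.F U * B.F (configShift x U) ∂μ) -
          (∫ U, A.F U ∂μ) * ∫ U, B.F (configShift x U) ∂μ| ≤ CB * (C * Real.exp (-(m * L))) := hcov
      _ = CB * C * (Real.exp (m * (RB + 1)) * Real.exp (-(m * n))) := by rw [hexp]; ring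
      _ ≤ (2 * CA * CB + CB * C) * (Real.exp (m * (RB + 1)) * Real.exp (-(m * n))) := by
          refine mul_le_mul_of_nonneg_right ?_ (by positivity)
          linarith only [mul_nonneg hCA0 hCB0]
      _ = (2 * CA * CB + CB * C) * Real.exp (m * (RB + 1)) * Real.exp (-(m * n)) := by ring

end Summit.QuantumFields.YangMills.Theorems.NonSimplyConnectedLatticeGap

end
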